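import Summits.CriticalPhenomena.PercolationContinuityZ3.Theorems.PercNearOneGluingNoHeavyLowerTailMajorityGluingQCertSymParts
import HarnessLib

/-!
# Part 2 of 18 of the orbit certificate of the cell `(12,7)` at `c = 157/100`: data and digest (lane prim-rate, constants-miner 1, gen 36; generated by cert/mksym.py)

Support file for the closed crux `NoHeavyLowerTail` (stmt-CriticalPhenomena-4575), majority-gluing line.  The symmetrised certificate of the cell `(12,7)`
(kit j286395, symcert.py) is checked IN PARTS (`…MajorityGluingQCertSymParts`): this file holds part 2 (0 multiplier terms, 2 marginal slacks,
0 rows, 0 squares; 4098 contributions) and its DIGEST `twelveSevenSymP2D` (43 orbit keys), verified by `decide +kernel` (`twelveSevenSymP2_digest`).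
The parts are glued in `…MajorityGluingQCertSymTwelveSeven`.  No sorries. [cite: VandenbergKahn2001, Thm 1.2 (p. 123)]
-/

namespace Summit.CriticalPhenomena.PercolationContinuityZ3.Theorems

namespace HubOnly
namespace QCert

/-- Row representatives of part 2: `(A, X, B, Y, n, masks of f(A,X), f(B,Y), f(A∪B,X∩Y), f(∅,X∪Y))`. -/
def twelveSevenSymP2Rows : List RowE :=
  []

/-- Square representatives of part 2: `(a, b, n, mask₁, mask₂)`. -/
def twelveSevenSymP2Sqs : List SqE :=
  []

/-- **Part 2** of the `(12,7)` orbit certificate at `157/100`. -/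
def twelveSevenSymP2 : SymCert :=
  ⟨⟨12, 7, 157, 100, 1, [], [], []⟩,
    [],
    [(0, 4096, 135611584204850576), (0, 1023, 60398322531166150656)],
    [twelveSevenSymP2Rows], [twelveSevenSymP2Sqs]⟩

/-- The digest of part 2: `(orbit key, coefficient total)` in increasing key order (computed by cert/mksym.py, verified below). -/
def twelveSevenSymP2D : List (ℕ × ℤ) :=
  [((5120 : ℕ), (60398322531166150656 : ℤ)), (13314, 543584902780495355904), (14336, 120796645062332301312), (29702, 2174339611121981423616), 
    (30722, 1087169805560990711808), (32768, 60398322531166150656), (62478, 5073459092617956655104), (63494, 4348679222243962847232), 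
    (65538, 543584902780495355904), (128030, 7610188638926934982656), (129038, 10146918185235913310208), (131078, 2174339611121981423616), 
    (259134, 7610188638926934982656), (260126, 15220377277853869965312), (262158, 5073459092617956655104), (521342, 5073459092617956655104), 
    (522302, 15220377277853869965312), (524318, 7610188638926934982656), (1045758, 2174339611121981423616), (1046654, 10146918185235913310208), 
    (1048638, 7610188638926934982656), (2094590, 543584902780495355904), (2095358, 4348679222243962847232), (2097278, 5073459092617956655104), 
    (4192254, 60398322531166150656), (4192766, 1087169805560990711808), (4193278, 120796645062332301312), (4194558, 2174339611121981423616), 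
    (4194814, 543584902780495355904), (4195326, 60398322531166150656), (16781313, 135611584204850576), (16781315, 1491727426253356336), 
    (16781319, 7458637131266781680), (16781327, 22375911393800345040), (16781343, 44751822787600690080), (16781375, 62652551902640966112), 
    (16781439, 62652551902640966112), (16781567, 44751822787600690080), (16781823, 22375911393800345040), (16782335, -52939685399899368976), 
    (16783359, 1491727426253356336), (16785407, 135611584204850576), (16785408, -135611584204850576)]

/-- **The digest of part 2 is `twelveSevenSymP2D`** (kernel evaluation of the part's 4098 contributions). -/
theorem twelveSevenSymP2_digest : twelveSevenSymP2.digest 20 = twelveSevenSymP2D := by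
  decide +kernel

end QCert
end HubOnly

end Summit.CriticalPhenomena.PercolationContinuityZ3.Theorems
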